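import Mathlib.MeasureTheory.Integral.IntervalIntegral.IntegrationByParts
import Literature.Barriers.AnomalousDissipation.VortexSheetSubsolution
import HarnessLib

/-!
# Székelyhidi's vortex-sheet subsolution, II: the rarefaction fan is a weak solution of the
  Burgers equation (one-dimensional integrations by parts)

Topic `Barriers/AnomalousDissipation`, second layer of the proof of
`Literature.Barriers.AnomalousDissipation.Szekelyhidi2011_thm11` (Székelyhidi, C. R. Math. 349
(2011), Thm. 1.1) from the convex-integration fact
`Literature.Analysis.FluidPDE.Torus.Szekelyhidi2011_thm13`, see
`Literature/Barriers/AnomalousDissipation/VortexSheetSubsolution.lean` for the fields.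

Székelyhidi 2011, §2: "With these choices the system (3) reduces to `∂ₜα + ∂_{x₂}γ = 0` (9) …
(9) becomes the inviscid Burgers equation `∂ₜα + (λ/2)∂_{x₂}α² = 0` … Set `α` to be the (unique)
viscosity solution, given by a rarefaction wave". The rarefaction fan `α` (`VortexSheet.fanFun`,
`λ = ½`) is continuous for `t > 0` and piecewise smooth, so (9) holds in the sense of
distributions iff it holds piecewise classically — which it does: in the fan
`∂ₜ(2y/t) + ∂_y(y²/t² - ¼) = -2y/t² + 2y/t² = 0`, and outside both terms vanish. This file
proves the two one-dimensional integrations by parts that express this: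

* `VortexSheet.γfun t y = -(1 - fanFun t y²)/4` (the flux `γ` on the fundamental interval) and
  `VortexSheet.dαfun t y = -2y/t² · 1_{2|y| < t}` (the a.e. time derivative `∂ₜα`; the a.e.
  space derivative of `γ` is `-dαfun`);
* `VortexSheet.intervalIntegral_γfun_mul_deriv` — **space**: for `0 < t < 1` and `g ∈ C¹(ℝ)`,
  `∫_{-½}^{½} γ(t,y) g'(y) dy = ∫_{-½}^{½} ∂ₜα(t,y) g(y) dy` (`= -∫ ∂_yγ · g`; no boundary terms
  since `γ(t, ±t/2) = 0`);
* `VortexSheet.intervalIntegral_fanFun_mul_deriv` — **time**: for `|y| ≤ ½` and `h ∈ C¹(ℝ)`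
  with `h(0) = h(1) = 0`, `∫₀¹ α(t,y) h'(t) dt = -∫₀¹ ∂ₜα(t,y) h(t) dt`.

Adding the two (after Fubini on `(0,1) × T²`, next file) gives the weak form of (9).

## References

* L. Székelyhidi Jr., C. R. Math. Acad. Sci. Paris 349 (2011) 1063–1066, §2, (9)–(10)
  (`Szekelyhidi2011`).
-/

open MeasureTheory Set Filter Function

noncomputable section

namespace Literature.Barriers.AnomalousDissipation

namespace VortexSheet

/-! ## The flux and the a.e. derivatives on the fundamental interval -/

/-- The sign datum `s(y) = 1` for `y > 0`, `-1` for `y ≤ 0` (`= fanFun t y` for `t ≤ 0`).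
[cite: Szekelyhidi2011, (1)] -/
def sgn (y : ℝ) : ℝ := if 0 < y then 1 else -1

/-- The flux `γ = -(λ/2)(1 - α²) = -(1 - α²)/4` on the fundamental interval (`λ = ½`).
[cite: Szekelyhidi2011, §2] -/
def γfun (t y : ℝ) : ℝ := -(1 - fanFun t y ^ 2) / 4

/-- The a.e. time derivative of the fan: `∂ₜα(t,y) = -2y/t²` inside the fan `2|y| < t`, `0`
outside. Its negative is the a.e. `y`-derivative of `γ`. [cite: Szekelyhidi2011, (9)–(10)] -/
def dαfun (t y : ℝ) : ℝ := if 2 * |y| < t then -(2 * y / t ^ 2) else 0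

/-- For `t ≤ 0`, `fanFun t y = sgn y`. [folklore] -/
theorem fanFun_of_nonpos {t : ℝ} (ht : t ≤ 0) (y : ℝ) : fanFun t y = sgn y := by
  simp [fanFun, sgn, not_lt.2 ht]

/-- Before the fan reaches `y ≠ 0` (`t ≤ 2|y|`), `α(t,y) = sgn y`. [cite: Szekelyhidi2011, (10)] -/
theorem fanFun_eq_sgn {t y : ℝ} (hy : y ≠ 0) (ht : t ≤ 2 * |y|) : fanFun t y = sgn y := by
  rcases le_or_gt t 0 with ht0 | ht0
  · exact fanFun_of_nonpos ht0 y
  · rcases lt_or_gt_of_ne hy with hy0 | hy0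
    · rw [abs_of_neg hy0] at ht
      rw [fanFun_of_le ht0 (by linarith), sgn, if_neg (not_lt.2 hy0.le)]
    · rw [abs_of_pos hy0] at ht
      rw [fanFun_of_ge ht0 (by linarith), sgn, if_pos hy0]

/-- Outside the fan the flux vanishes: `γ(t,y) = 0` for `t/2 ≤ |y|`, `t > 0`. [folklore] -/
theorem γfun_eq_zero {t y : ℝ} (ht : 0 < t) (h : t / 2 ≤ |y|) : γfun t y = 0 := by
  unfold γfun
  rcases le_or_gt 0 y with hy | hy
  · rw [abs_of_nonneg hy] at h
    rw [fanFun_of_ge ht h]; norm_num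
  · rw [abs_of_neg hy] at h
    rw [fanFun_of_le ht (by linarith)]; norm_num

/-- Inside the fan the flux is the parabola `γ(t,y) = y²/t² - ¼` (`|y| ≤ t/2`, `t > 0`).
[folklore] -/
theorem γfun_eq_of_abs_le {t y : ℝ} (ht : 0 < t) (h : |y| ≤ t / 2) :
    γfun t y = y ^ 2 / t ^ 2 - 1 / 4 := by
  unfold γfun
  rw [fanFun_of_abs_le ht h]
  field_simp
  ring

/-- `dαfun t y = 0` outside the fan. [folklore] -/
theorem dαfun_of_not_lt {t y : ℝ} (h : ¬ 2 * |y| < t) : dαfun t y = 0 := by simp [dαfun, h]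

/-- `dαfun t y = -2y/t²` inside the fan. [folklore] -/
theorem dαfun_of_lt {t y : ℝ} (h : 2 * |y| < t) : dαfun t y = -(2 * y / t ^ 2) := by
  simp [dαfun, h]

/-- `dαfun t y · g y` is the indicator of the open fan `(-t/2, t/2)` applied to
`y ↦ -(2y/t²) g y` (as a function of `y`). [folklore] -/
theorem dαfun_mul_eq_indicator_space (t : ℝ) (g : ℝ → ℝ) :
    (fun y => dαfun t y * g y) =
      (Ioo (-(t / 2)) (t / 2)).indicator fun y => -(2 * y / t ^ 2) * g y := by
  funext y
  by_cases h : 2 * |y| < t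
  · have h' : |y| < t / 2 := by linarith
    have hy : y ∈ Ioo (-(t / 2)) (t / 2) := by
      rw [abs_lt] at h'
      exact ⟨h'.1, h'.2⟩
    rw [dαfun_of_lt h, indicator_of_mem hy]
  · have hy : y ∉ Ioo (-(t / 2)) (t / 2) := by
      rintro ⟨h1, h2⟩
      have h' : |y| < t / 2 := abs_lt.2 ⟨h1, h2⟩
      exact h (by linarith)
    rw [dαfun_of_not_lt h, indicator_of_notMem hy, zero_mul]

/-- `dαfun t y · h t` is the indicator of the time interval `(2|y|, ∞)` applied to
`t ↦ -(2y/t²) h t` (as a function of `t`). [folklore] -/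
theorem dαfun_mul_eq_indicator_time (y : ℝ) (h : ℝ → ℝ) :
    (fun t => dαfun t y * h t) = (Ioi (2 * |y|)).indicator fun t => -(2 * y / t ^ 2) * h t := by
  funext t
  by_cases ht : 2 * |y| < t
  · rw [dαfun_of_lt ht, indicator_of_mem (mem_Ioi.2 ht)]
  · rw [dαfun_of_not_lt ht, indicator_of_notMem (fun h' => ht (mem_Ioi.1 h')), zero_mul]

/-- `|dαfun t y| ≤ 1/t` for `t > 0` (inside the fan `2|y| < t`). [folklore] -/
theorem abs_dαfun_le {t : ℝ} (ht : 0 < t) (y : ℝ) : |dαfun t y| ≤ 1 / t := by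
  by_cases h : 2 * |y| < t
  · rw [dαfun_of_lt h, abs_neg, abs_div, abs_mul, abs_two, abs_of_pos (pow_pos ht 2),
      div_le_div_iff₀ (pow_pos ht 2) ht]
    nlinarith [abs_nonneg y]
  · rw [dαfun_of_not_lt h, abs_zero]
    positivity

/-- `dαfun` is jointly measurable. [folklore] -/
theorem measurable_dαfun : Measurable (uncurry dαfun) := by
  have h : uncurry dαfun =
      fun p : ℝ × ℝ => if 2 * |p.2| < p.1 then -(2 * p.2 / p.1 ^ 2) else 0 := by
    funext p; rfl
  rw [h]
  refine Measurable.ite ?_ (by fun_prop) measurable_const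
  exact measurableSet_lt (by fun_prop) measurable_fst

/-- For `t > 0`, `y ↦ fanFun t y` is continuous. [folklore] -/
theorem continuous_fanFun_right {t : ℝ} (ht : 0 < t) : Continuous fun y => fanFun t y := by
  have h : (fun y => fanFun t y) = fun y => clamp1 (2 * y / t) := funext fun y => fanFun_of_pos ht y
  rw [h]
  exact continuous_clamp1.comp (by fun_prop)

/-- For `t > 0`, `y ↦ γfun t y` is continuous. [folklore] -/
theorem continuous_γfun_right {t : ℝ} (ht : 0 < t) : Continuous fun y => γfun t y := by
  unfold γfun
  have := continuous_fanFun_right ht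
  fun_prop

/-- `t ↦ fanFun t y` is measurable. [folklore] -/
theorem measurable_fanFun_left (y : ℝ) : Measurable fun t => fanFun t y :=
  measurable_fanFun.comp (measurable_id.prodMk measurable_const)

/-! ## Space: `∫ γ g' = ∫ ∂ₜα g` on the fundamental interval -/

/-- **Integration by parts in `x₂` across the fan** (the space half of the weak form of (9)):
for `0 < t < 1` and `g ∈ C¹(ℝ)`,
`∫_{-½}^{½} γ(t,y) g'(y) dy = ∫_{-½}^{½} ∂ₜα(t,y) g(y) dy` — i.e. `= -∫ ∂_yγ · g` with
`∂_yγ = 2y/t² = -∂ₜα` in the fan; `γ(t,·)` vanishes identically outside the fan and at its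
edges `±t/2`, so no boundary terms arise. [cite: Szekelyhidi2011, §2 (9)–(10)] -/
theorem intervalIntegral_γfun_mul_deriv {t : ℝ} (ht : 0 < t) (ht1 : t < 1) {g g' : ℝ → ℝ}
    (hg : ∀ y, HasDerivAt g (g' y) y) (hg' : Continuous g') :
    ∫ y in (-(1 / 2 : ℝ))..(1 / 2), γfun t y * g' y =
      ∫ y in (-(1 / 2 : ℝ))..(1 / 2), dαfun t y * g y := by
  have hgc : Continuous g := continuous_iff_continuousAt.2 fun y => (hg y).continuousAt
  -- integrability of the two integrands on every interval
  have hIL : ∀ a b : ℝ, IntervalIntegrable (fun y => γfun t y * g' y) volume a b := fun a b =>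
    ((continuous_γfun_right ht).mul hg').intervalIntegrable a b
  have hIR : ∀ a b : ℝ, IntervalIntegrable (fun y => dαfun t y * g y) volume a b := by
    intro a b
    rw [dαfun_mul_eq_indicator_space]
    have hc : Continuous fun y : ℝ => -(2 * y / t ^ 2) * g y := by fun_prop
    exact (hc.integrableOn_uIcc.indicator measurableSet_Ioo).intervalIntegrable
  -- split at `-t/2` and `t/2`
  have hsplitL : ∫ y in (-(1 / 2 : ℝ))..(1 / 2), γfun t y * g' y =
      (∫ y in (-(1 / 2 : ℝ))..(-(t / 2)), γfun t y * g' y) +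
        ((∫ y in (-(t / 2))..(t / 2), γfun t y * g' y) +
          ∫ y in (t / 2)..(1 / 2), γfun t y * g' y) := by
    rw [intervalIntegral.integral_add_adjacent_intervals (hIL _ _) (hIL _ _),
      intervalIntegral.integral_add_adjacent_intervals (hIL _ _) (hIL _ _)]
  have hsplitR : ∫ y in (-(1 / 2 : ℝ))..(1 / 2), dαfun t y * g y =
      (∫ y in (-(1 / 2 : ℝ))..(-(t / 2)), dαfun t y * g y) +
        ((∫ y in (-(t / 2))..(t / 2), dαfun t y * g y) +
          ∫ y in (t / 2)..(1 / 2), dαfun t y * g y) := by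
    rw [intervalIntegral.integral_add_adjacent_intervals (hIR _ _) (hIR _ _),
      intervalIntegral.integral_add_adjacent_intervals (hIR _ _) (hIR _ _)]
  -- the outer pieces vanish on both sides
  have hL1 : ∫ y in (-(1 / 2 : ℝ))..(-(t / 2)), γfun t y * g' y = 0 := by
    rw [intervalIntegral.integral_congr (g := fun _ => (0 : ℝ)) fun y hy => ?_,
      intervalIntegral.integral_zero]
    rw [uIcc_of_le (by linarith)] at hy
    show γfun t y * g' y = 0
    rw [γfun_eq_zero ht (by rw [abs_of_neg (by linarith [hy.2])]; linarith [hy.2]), zero_mul]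
  have hL3 : ∫ y in (t / 2)..(1 / 2 : ℝ), γfun t y * g' y = 0 := by
    rw [intervalIntegral.integral_congr (g := fun _ => (0 : ℝ)) fun y hy => ?_,
      intervalIntegral.integral_zero]
    rw [uIcc_of_le (by linarith)] at hy
    show γfun t y * g' y = 0
    rw [γfun_eq_zero ht (by rw [abs_of_pos (by linarith [hy.1])]; exact hy.1), zero_mul]
  have hR1 : ∫ y in (-(1 / 2 : ℝ))..(-(t / 2)), dαfun t y * g y = 0 := by
    rw [intervalIntegral.integral_congr (g := fun _ => (0 : ℝ)) fun y hy => ?_,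
      intervalIntegral.integral_zero]
    rw [uIcc_of_le (by linarith)] at hy
    show dαfun t y * g y = 0
    rw [dαfun_of_not_lt (by rw [abs_of_neg (by linarith [hy.2])]; linarith [hy.2]), zero_mul]
  have hR3 : ∫ y in (t / 2)..(1 / 2 : ℝ), dαfun t y * g y = 0 := by
    rw [intervalIntegral.integral_congr (g := fun _ => (0 : ℝ)) fun y hy => ?_,
      intervalIntegral.integral_zero]
    rw [uIcc_of_le (by linarith)] at hy
    show dαfun t y * g y = 0
    rw [dαfun_of_not_lt (by rw [abs_of_pos (by linarith [hy.1])]; linarith [hy.1]), zero_mul]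
  -- the middle piece: integrate by parts with the parabola `P(y) = y²/t² - ¼`, `P(±t/2) = 0`
  have hP : ∀ y, HasDerivAt (fun y : ℝ => y ^ 2 / t ^ 2 - 1 / 4) (2 * y / t ^ 2) y := by
    intro y
    have h1 : HasDerivAt (fun y : ℝ => y ^ 2 / t ^ 2) (2 * y ^ 1 * 1 / t ^ 2) y :=
      ((hasDerivAt_id y).pow 2).div_const _
    simpa using h1.sub_const (1 / 4 : ℝ)
  have hmidL : ∫ y in (-(t / 2))..(t / 2), γfun t y * g' y =
      -∫ y in (-(t / 2))..(t / 2), 2 * y / t ^ 2 * g y := by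
    have heq : ∫ y in (-(t / 2))..(t / 2), γfun t y * g' y =
        ∫ y in (-(t / 2))..(t / 2), (y ^ 2 / t ^ 2 - 1 / 4) * g' y := by
      refine intervalIntegral.integral_congr fun y hy => ?_
      rw [uIcc_of_le (by linarith)] at hy
      show γfun t y * g' y = (y ^ 2 / t ^ 2 - 1 / 4) * g' y
      rw [γfun_eq_of_abs_le ht (abs_le.2 ⟨hy.1, hy.2⟩)]
    rw [heq, intervalIntegral.integral_mul_deriv_eq_deriv_mul (fun y _ => hP y) (fun y _ => hg y)
      ((by fun_prop : Continuous fun y : ℝ => 2 * y / t ^ 2).intervalIntegrable _ _)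
      (hg'.intervalIntegrable _ _)]
    have ht0 : t ≠ 0 := ht.ne'
    have e1 : (t / 2) ^ 2 / t ^ 2 - 1 / 4 = 0 := by field_simp; ring
    have e2 : (-(t / 2)) ^ 2 / t ^ 2 - 1 / 4 = 0 := by field_simp; ring
    rw [e1, e2]
    ring
  have hmidR : ∫ y in (-(t / 2))..(t / 2), dαfun t y * g y =
      -∫ y in (-(t / 2))..(t / 2), 2 * y / t ^ 2 * g y := by
    rw [← intervalIntegral.integral_neg]
    refine intervalIntegral.integral_congr_uIoo fun y hy => ?_
    rw [uIoo_of_le (by linarith)] at hy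
    show dαfun t y * g y = -(2 * y / t ^ 2 * g y)
    have hy' : |y| < t / 2 := abs_lt.2 ⟨hy.1, hy.2⟩
    rw [dαfun_of_lt (by linarith)]
    ring
  rw [hsplitL, hsplitR, hL1, hL3, hR1, hR3, hmidL, hmidR]


/-! ## Time: `∫ α h' = -∫ ∂ₜα h` on `[0, 1]` -/

/-- `2y/(2|y|) = sgn y` for `y ≠ 0`. [folklore] -/
theorem two_mul_div_two_mul_abs {y : ℝ} (hy : y ≠ 0) : 2 * y / (2 * |y|) = sgn y := by
  rcases lt_or_gt_of_ne hy with h | h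
  · rw [abs_of_neg h, sgn, if_neg (not_lt.2 h.le)]
    field_simp
  · rw [abs_of_pos h, sgn, if_pos h]
    field_simp

/-- `t ↦ fanFun t y · h' t` is integrable on every interval (bounded measurable times
continuous). [folklore] -/
theorem intervalIntegrable_fanFun_mul (y : ℝ) {h' : ℝ → ℝ} (hh' : Continuous h') (a b : ℝ) :
    IntervalIntegrable (fun t => fanFun t y * h' t) volume a b := by
  rw [intervalIntegrable_iff]
  have hg : IntegrableOn h' (Set.uIoc a b) volume :=
    (intervalIntegrable_iff).1 (hh'.intervalIntegrable a b)
  exact hg.bdd_mul (measurable_fanFun_left y).aestronglyMeasurable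
    (ae_of_all _ fun t => (abs_fanFun_le t y : ‖fanFun t y‖ ≤ 1))

/-- **Integration by parts in `t` across the fan** (the time half of the weak form of (9)): for
`|y| ≤ ½` and `h ∈ C¹(ℝ)` with `h(0) = h(1) = 0`,
`∫₀¹ α(t,y) h'(t) dt = -∫₀¹ ∂ₜα(t,y) h(t) dt`: before the fan reaches `y` (`t ≤ 2|y|`) `α = ±1`
is constant, afterwards `α = 2y/t` with `∂ₜα = -2y/t²`, and `α(·, y)` is continuous at
`t = 2|y|`, so the boundary terms cancel. [cite: Szekelyhidi2011, §2 (9)–(10)] -/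
theorem intervalIntegral_fanFun_mul_deriv {y : ℝ} (hy : |y| ≤ 1 / 2) {h h' : ℝ → ℝ}
    (hh : ∀ t, HasDerivAt h (h' t) t) (hh' : Continuous h') (h0 : h 0 = 0) (h1 : h 1 = 0) :
    ∫ t in (0 : ℝ)..1, fanFun t y * h' t = -∫ t in (0 : ℝ)..1, dαfun t y * h t := by
  have hhc : Continuous h := continuous_iff_continuousAt.2 fun t => (hh t).continuousAt
  by_cases hy0 : y = 0
  · subst hy0
    have hL : ∫ t in (0 : ℝ)..1, fanFun t 0 * h' t = 0 := by
      rw [intervalIntegral.integral_congr_uIoo (g := fun _ => (0 : ℝ)) fun t ht => ?_,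
        intervalIntegral.integral_zero]
      rw [uIoo_of_le zero_le_one] at ht
      show fanFun t 0 * h' t = 0
      rw [fanFun_of_abs_le ht.1 (by rw [abs_zero]; linarith [ht.1])]
      simp
    have hR : ∫ t in (0 : ℝ)..1, dαfun t 0 * h t = 0 := by
      have h' : ∀ t, dαfun t 0 * h t = 0 := fun t => by
        unfold dαfun
        split_ifs <;> simp
      simp_rw [h']
      exact intervalIntegral.integral_zero
    rw [hL, hR, neg_zero]
  -- `y ≠ 0`: the fan reaches `y` at time `T = 2|y| ∈ (0, 1]`
  set T : ℝ := 2 * |y| with hT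
  have hypos : 0 < |y| := abs_pos.2 hy0
  have hT0 : 0 < T := by positivity
  have hT1 : T ≤ 1 := by linarith
  have hsgn : 2 * y / T = sgn y := two_mul_div_two_mul_abs hy0
  -- integrability of the right-hand integrand on the two pieces
  have hIR1 : IntervalIntegrable (fun t => dαfun t y * h t) volume 0 T := by
    rw [intervalIntegrable_iff_integrableOn_Icc_of_le hT0.le]
    refine integrableOn_zero.congr_fun (fun t ht => ?_) measurableSet_Icc
    show (0 : ℝ) = dαfun t y * h t
    rw [dαfun_of_not_lt (not_lt.2 ht.2), zero_mul]
  have hcont2 : ContinuousOn (fun t => -(2 * y / t ^ 2) * h t) (Icc T 1) := by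
    refine ContinuousOn.mul (ContinuousOn.neg (ContinuousOn.div continuousOn_const
      (by fun_prop) fun t ht => ?_)) hhc.continuousOn
    exact pow_ne_zero 2 (by linarith [ht.1] : t ≠ 0)
  have hIR2 : IntervalIntegrable (fun t => dαfun t y * h t) volume T 1 := by
    rw [intervalIntegrable_iff_integrableOn_Ioc_of_le hT1]
    refine ((hcont2.integrableOn_compact isCompact_Icc).mono_set Ioc_subset_Icc_self).congr_fun
      (fun t ht => ?_) measurableSet_Ioc
    show -(2 * y / t ^ 2) * h t = dαfun t y * h t
    rw [dαfun_of_lt ht.1]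
  -- split both sides at `T`
  rw [← intervalIntegral.integral_add_adjacent_intervals (intervalIntegrable_fanFun_mul y hh' 0 T)
      (intervalIntegrable_fanFun_mul y hh' T 1),
    ← intervalIntegral.integral_add_adjacent_intervals hIR1 hIR2]
  -- piece `[0, T]`: `α = sgn y` constant, `∂ₜα = 0`
  have hL1 : ∫ t in (0 : ℝ)..T, fanFun t y * h' t = sgn y * h T := by
    have heq : ∫ t in (0 : ℝ)..T, fanFun t y * h' t = ∫ t in (0 : ℝ)..T, sgn y * h' t := by
      refine intervalIntegral.integral_congr fun t ht => ?_
      rw [uIcc_of_le hT0.le] at ht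
      show fanFun t y * h' t = sgn y * h' t
      rw [fanFun_eq_sgn hy0 ht.2]
    rw [heq, intervalIntegral.integral_const_mul,
      intervalIntegral.integral_eq_sub_of_hasDerivAt (fun t _ => hh t) (hh'.intervalIntegrable _ _),
      h0, sub_zero]
  have hR1 : ∫ t in (0 : ℝ)..T, dαfun t y * h t = 0 := by
    rw [intervalIntegral.integral_congr (g := fun _ => (0 : ℝ)) fun t ht => ?_,
      intervalIntegral.integral_zero]
    rw [uIcc_of_le hT0.le] at ht
    show dαfun t y * h t = 0
    rw [dαfun_of_not_lt (not_lt.2 ht.2), zero_mul]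
  -- piece `[T, 1]`: `α = 2y/t`, integrate by parts
  have hu : ∀ t ∈ uIcc T 1, HasDerivAt (fun t : ℝ => 2 * y / t) (-(2 * y / t ^ 2)) t := by
    intro t ht
    rw [uIcc_of_le hT1] at ht
    have ht0 : t ≠ 0 := by linarith [ht.1]
    have h := (hasDerivAt_const t (2 * y)).div (hasDerivAt_id t) ht0
    refine h.congr_deriv ?_
    simp only [id_eq]
    ring
  have hL2 : ∫ t in T..(1 : ℝ), fanFun t y * h' t =
      -(sgn y * h T) + ∫ t in T..(1 : ℝ), 2 * y / t ^ 2 * h t := by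
    have heq : ∫ t in T..(1 : ℝ), fanFun t y * h' t = ∫ t in T..(1 : ℝ), 2 * y / t * h' t := by
      refine intervalIntegral.integral_congr fun t ht => ?_
      rw [uIcc_of_le hT1] at ht
      show fanFun t y * h' t = 2 * y / t * h' t
      rw [fanFun_of_abs_le (by linarith [ht.1]) (by linarith [ht.1])]
    have hu' : IntervalIntegrable (fun t : ℝ => -(2 * y / t ^ 2)) volume T 1 := by
      refine ContinuousOn.intervalIntegrable ?_
      rw [uIcc_of_le hT1]
      refine ContinuousOn.neg (ContinuousOn.div continuousOn_const (by fun_prop) fun t ht => ?_)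
      exact pow_ne_zero 2 (by linarith [ht.1] : t ≠ 0)
    rw [heq, intervalIntegral.integral_mul_deriv_eq_deriv_mul hu (fun t _ => hh t) hu'
      (hh'.intervalIntegrable _ _), h1, mul_zero, zero_sub, hsgn]
    have hneg : ∫ t in T..(1 : ℝ), -(2 * y / t ^ 2) * h t =
        -∫ t in T..(1 : ℝ), 2 * y / t ^ 2 * h t := by
      rw [← intervalIntegral.integral_neg]
      refine intervalIntegral.integral_congr fun t _ => ?_
      show -(2 * y / t ^ 2) * h t = -(2 * y / t ^ 2 * h t)
      ring
    rw [hneg]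
    ring
  have hR2 : ∫ t in T..(1 : ℝ), dαfun t y * h t = -∫ t in T..(1 : ℝ), 2 * y / t ^ 2 * h t := by
    rw [← intervalIntegral.integral_neg]
    refine intervalIntegral.integral_congr_uIoo fun t ht => ?_
    rw [uIoo_of_le hT1] at ht
    show dαfun t y * h t = -(2 * y / t ^ 2 * h t)
    rw [dαfun_of_lt ht.1]
    ring
  rw [hL1, hR1, hL2, hR2]
  ring

end VortexSheet

end Literature.Barriers.AnomalousDissipation
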